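import Mathlib
import Literature.Combinatorics.Additive.TripleProductProperty
import Summits.MatrixMultiplication.MatrixMultiplication.Theorems.SnSubsetDichotomyThresholdSubsetTriplesRiemannHurwitz

/-!
# The genus certificate for the triple product property (line `SketchIdeator6` of crux
`SnSubsetDichotomy.ThresholdSubsetTriples`, stmt-MatrixMultiplication-10882) — by-product `tpp_of_genusCertificate`

A triple `(S, T, U)` of subsets of `S_n` is GENUS-CERTIFIED when its quotient sets
`Q(X) = {x x'⁻¹}` are pairwise disjoint away from `1` and every triple of NON-TRIVIAL quotients
`q₁ ∈ Q(S), q₂ ∈ Q(T), q₃ ∈ Q(U)` is "too short to close up":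
`n + 2·orb⟨q₁,q₂,q₃⟩ < cyc q₁ + cyc q₂ + cyc q₃` (cycles including fixed points; orbits of the
subgroup generated by the three quotients).  Such a triple has the triple product property: a closing
triple `q₁q₂q₃ = 1` generates the same group as `q₁, q₂`, and the Riemann–Hurwitz inequality
(`riemannHurwitz_perm`) gives `cyc q₁ + cyc q₂ + cyc (q₁q₂) ≤ n + 2·orb⟨q₁,q₂⟩`, with
`cyc q₃ = cyc (q₁q₂)`; if one quotient is trivial the other two are mutually inverse, excluded by the
pairwise clauses.  This is the soundness half of card `riemann-hurwitz-short-triples`; the design half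
(`stub_genusThreshold`) is open.
-/

namespace Summit.MatrixMultiplication.MatrixMultiplication.Theorems.ThresholdSubsetTriples

open Literature.Combinatorics.Additive

/-- **Genus-certified triples have the triple product property** (soundness of the
Riemann–Hurwitz certificate; unconditional). -/
theorem tpp_of_genusCertificate : ∀ (n : ℕ) (S T U : Finset (Equiv.Perm (Fin n))), (∀ s ∈ S, ∀ s' ∈ S, ∀ t ∈ T, ∀ t' ∈ T, s * s'⁻¹ = t * t'⁻¹ → s = s' ∧ t = t') → (∀ t ∈ T, ∀ t' ∈ T, ∀ u ∈ U, ∀ u' ∈ U, t * t'⁻¹ = u * u'⁻¹ → t = t' ∧ u = u') → (∀ u ∈ U, ∀ u' ∈ U, ∀ s ∈ S, ∀ s' ∈ S, u * u'⁻¹ = s * s'⁻¹ → u = u' ∧ s = s') → (∀ s ∈ S, ∀ s' ∈ S, ∀ t ∈ T, ∀ t' ∈ T, ∀ u ∈ U, ∀ u' ∈ U, s ≠ s' → t ≠ t' → u ≠ u' → n + 2 * Nat.card (MulAction.orbitRel.Quotient (Subgroup.closure ({s * s'⁻¹, t * t'⁻¹, u * u'⁻¹} : Set (Equiv.Perm (Fin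 n)))) (Fin n)) < Nat.card (MulAction.orbitRel.Quotient (Subgroup.zpowers (s * s'⁻¹)) (Fin n)) + Nat.card (MulAction.orbitRel.Quotient (Subgroup.zpowers (t * t'⁻¹)) (Fin n)) + Nat.card (MulAction.orbitRel.Quotient (Subgroup.zpowers (u * u'⁻¹)) (Fin n))) → Literature.Combinatorics.Additive.TripleProductProperty S T U := by
  intro n S T U hST hTU hUS h3 s hs s' hs' t ht t' ht' u hu u' hu' heq
  by_cases h1 : s = s'
  · subst h1
    have htu : t * t'⁻¹ = (u * u'⁻¹)⁻¹ := by
      rw [eq_inv_iff_mul_eq_one]; simpa using heq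
    have htu' : t * t'⁻¹ = u' * u⁻¹ := by rw [htu]; group
    obtain ⟨e1, e2⟩ := hTU t ht t' ht' u' hu' u hu htu'
    exact ⟨rfl, e1, e2.symm⟩
  by_cases h2 : t = t'
  · subst h2
    have hsu : s * s'⁻¹ = (u * u'⁻¹)⁻¹ := by
      rw [eq_inv_iff_mul_eq_one]; simpa using heq
    have hsu' : u' * u⁻¹ = s * s'⁻¹ := by rw [hsu]; group
    obtain ⟨e1, e2⟩ := hUS u' hu' u hu s hs s' hs' hsu'
    exact ⟨e2, rfl, e1.symm⟩
  by_cases h3' : u = u'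
  · subst h3'
    have hst : s * s'⁻¹ = (t * t'⁻¹)⁻¹ := by
      rw [eq_inv_iff_mul_eq_one]; simpa using heq
    have hst' : s * s'⁻¹ = t' * t⁻¹ := by rw [hst]; group
    obtain ⟨e1, e2⟩ := hST s hs s' hs' t' ht' t ht hst'
    exact ⟨e1, e2.symm, rfl⟩
  exfalso
  have hlt := h3 s hs s' hs' t ht t' ht' u hu u' hu' h1 h2 h3'
  have hle := riemannHurwitz_perm (Fin n) (s * s'⁻¹) (t * t'⁻¹)
  have hprod : s * s'⁻¹ * (t * t'⁻¹) = (u * u'⁻¹)⁻¹ := eq_inv_of_mul_eq_one_left heq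
  have hcl : Subgroup.closure ({s * s'⁻¹, t * t'⁻¹, u * u'⁻¹} : Set (Equiv.Perm (Fin n))) =
      Subgroup.closure ({s * s'⁻¹, t * t'⁻¹} : Set (Equiv.Perm (Fin n))) := by
    refine le_antisymm ((Subgroup.closure_le _).2 ?_) (Subgroup.closure_mono ?_)
    · have hu3 : u * u'⁻¹ = (s * s'⁻¹ * (t * t'⁻¹))⁻¹ := by rw [hprod, inv_inv]
      rintro x (rfl | rfl | hx)
      · exact Subgroup.subset_closure (by simp)
      · exact Subgroup.subset_closure (by simp)
      · rw [Set.mem_singleton_iff] at hx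
        rw [hx, hu3]
        exact Subgroup.inv_mem _ (Subgroup.mul_mem _ (Subgroup.subset_closure (by simp))
          (Subgroup.subset_closure (by simp)))
    · intro x hx
      rcases hx with rfl | rfl
      · simp
      · simp
  rw [hcl] at hlt
  rw [hprod, Subgroup.zpowers_inv, Nat.card_eq_fintype_card (α := Fin n), Fintype.card_fin] at hle
  omega

end Summit.MatrixMultiplication.MatrixMultiplication.Theorems.ThresholdSubsetTriples
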